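import Summits.KontsevichZagierPeriods.KontsevichZagierPeriods.Theses.PhiFourHepp
import Literature.NumberTheory.Transcendental.KZCalculus
import Literature.NumberTheory.Transcendental.SemialgebraicMaps

/-!
# `CremonaIsAMove` (stmt-KontsevichZagierPeriods-12293, route PhiFourHepp) — proof

Duality in Feynman's dictionary (Schnetz 2010, §2.2, "Cremona transformation") is ONE move of the
Kontsevich–Zagier calculus. For ANY integrand shape `p : ℝⁿ⁺¹ → ℝ` and representations
`r = [{x > 0} ⊆ ℝⁿ, 1/p(x,1)²]`, `r' = [{u > 0}, 1/((∏ⱼ uⱼ)·p(1/u,1))²]`, the two are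
KZ-equivalent: the Cremona inversion `Φ(u) = (1/u₀, …, 1/u_{n-1})` of the open positive orthant
is an involution (hence injective, with image the orthant), a `ℚ`-semialgebraic map (its
coordinates are the rational functions `1 / uⱼ`), differentiable with diagonal derivative
`diag(−1/uⱼ²)` of absolute determinant `∏ⱼ 1/uⱼ²`, and
`r'.integrand u = r.integrand (Φ u) · ∏ⱼ 1/uⱼ²` is the identity
`1/((∏ uⱼ) P)² = (1/P²) · ∏ 1/uⱼ²` with `P = p(1/u, 1)`. So `[r'] − [r]` is an instance of rule (2)
(`KZ.changeOfVariablesRel`), and `KZ.Equivalent r r'` follows by symmetry. `p` is arbitrary: it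
enters only through the two given integrands. No definitions.
-/

noncomputable section

open MeasureTheory Set
open Literature.NumberTheory.Transcendental
open Literature.ModelTheory.ExponentialFields (IsSemialgebraic)
open MvPolynomial (X)

namespace Summit.KontsevichZagierPeriods.PhiFourHepp

variable {n : ℕ}

/-- The Cremona inversion `u ↦ (1/uⱼ)ⱼ` is injective on every set (it is an involution,
`1/(1/a) = a`). [folklore] -/
theorem injOn_cremona (s : Set (Fin n → ℝ)) :
    InjOn (fun u : Fin n → ℝ => fun j => 1 / u j) s := by
  intro x _ y _ hxy
  funext j
  have h := congrFun hxy j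
  simpa only [one_div, inv_inj] using h

/-- The Cremona inversion maps the open positive orthant ONTO itself (`x = Φ (Φ x)`).
[folklore] -/
theorem image_cremona :
    (fun u : Fin n → ℝ => fun j => 1 / u j) '' {u | ∀ j, 0 < u j} = {x | ∀ j, 0 < x j} := by
  ext x
  constructor
  · rintro ⟨u, hu, rfl⟩
    exact fun j => one_div_pos.2 (hu j)
  · intro hx
    exact ⟨fun j => 1 / x j, fun j => one_div_pos.2 (hx j), funext fun j => one_div_one_div (x j)⟩

/-- The Cremona inversion is a `ℚ`-semialgebraic map on every `ℚ`-semialgebraic set missing the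
coordinate hyperplanes: its coordinates are the rational functions `1 / uⱼ` with non-vanishing
denominators (no Tarski–Seidenberg needed). [cite: BochnakCosteRoy1998, §2.2] -/
theorem isSemialgebraicMapOn_cremona {s : Set (Fin n → ℝ)} (hs : IsSemialgebraic ℚ s)
    (h0 : ∀ u ∈ s, ∀ j, u j ≠ 0) :
    IsSemialgebraicMapOn ℚ s (fun u : Fin n → ℝ => fun j => 1 / u j) := by
  refine IsSemialgebraicMapOn.of_forall hs fun j => ?_
  have h := isSemialgebraicFunOn_aeval_div_aeval hs (1 : MvPolynomial (Fin n) ℚ) (X j)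
    (fun u hu => by simpa using h0 u hu j)
  simpa using h

/-- The Cremona inversion has derivative the diagonal map `diag(−1/uⱼ²)` at every point off the
coordinate hyperplanes (coordinatewise `hasDerivAt_inv` composed with the projections).
[folklore] -/
theorem hasFDerivAt_cremona {u : Fin n → ℝ} (hu : ∀ j, u j ≠ 0) :
    HasFDerivAt (fun u : Fin n → ℝ => fun j => 1 / u j)
      (LinearMap.toContinuousLinearMap
        (Matrix.toLin' (Matrix.diagonal fun j : Fin n => -(u j ^ 2)⁻¹))) u := by
  refine hasFDerivAt_pi'' fun i => ?_
  have hfun : (fun x : Fin n → ℝ => (fun j => 1 / x j) i) = fun x => (x i)⁻¹ := by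
    funext x
    exact one_div (x i)
  rw [hfun]
  refine ((hasDerivAt_inv (hu i)).comp_hasFDerivAt u (hasFDerivAt_apply i u)).congr_fderiv
    (ContinuousLinearMap.ext fun v => ?_)
  simp [Matrix.mulVec_diagonal]

/-- The Jacobian `diag(−1/uⱼ²)` of the Cremona inversion has absolute determinant `∏ⱼ (uⱼ²)⁻¹`
(determinant of a diagonal matrix). [folklore] -/
theorem abs_det_cremonaJac (u : Fin n → ℝ) :
    |(LinearMap.toContinuousLinearMap
        (Matrix.toLin' (Matrix.diagonal fun j : Fin n => -(u j ^ 2)⁻¹))).det| =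
      ∏ j, (u j ^ 2)⁻¹ := by
  rw [LinearMap.det_toContinuousLinearMap, LinearMap.det_toLin', Matrix.det_diagonal,
    Finset.abs_prod]
  refine Finset.prod_congr rfl fun j _ => ?_
  rw [abs_neg, abs_inv, abs_pow, sq_abs]

/-- The integrand bookkeeping of the Cremona move: `1/((∏ uⱼ)·P)² = (1/P²)·∏ (uⱼ²)⁻¹`
(unconditionally, with `0⁻¹ = 0`). [folklore] -/
theorem one_div_prod_mul_sq (u : Fin n → ℝ) (P : ℝ) :
    1 / ((∏ j, u j) * P) ^ 2 = 1 / P ^ 2 * ∏ j, (u j ^ 2)⁻¹ := by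
  rw [Finset.prod_inv_distrib, Finset.prod_pow]
  ring

/-- **`CremonaIsAMove`** (route PhiFourHepp, stmt-KontsevichZagierPeriods-12293): for any
`p : ℝⁿ⁺¹ → ℝ`, a representation `r` on the open orthant `{x > 0} ⊆ ℝⁿ` with integrand
`1/p(x,1)²` and a representation `r'` on `{u > 0}` with integrand `1/((∏ⱼ uⱼ)·p(1/u,1))²` are
KZ-equivalent. Proof: `[r'] − [r] ∈ KZ.changeOfVariablesRel` along the Cremona inversion
`Φ(u) = 1/u` (semialgebraic, injective, `Φ({u>0}) = {x>0}`, `|det Φ'(u)| = ∏ 1/uⱼ²`, and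
`r'.integrand u = r.integrand (Φ u)·∏ 1/uⱼ²` by the two integrand hypotheses), then symmetry of
`KZ.Equivalent`. [cite: KontsevichZagier2001, §1.2 rule (2)] -/
theorem cremonaIsAMove_proof :
    Summit.KontsevichZagierPeriods.KontsevichZagierPeriods.Theses.PhiFourHepp.CremonaIsAMove := by
  intro n p r r' hr hri hr' hr'i
  have hpos : ∀ u ∈ r'.domain, ∀ j, 0 < u j := fun u hu => by
    rw [hr'] at hu
    exact hu
  have hmem : KZ.of r' - KZ.of r ∈ KZ.changeOfVariablesRel := by
    refine ⟨n, r', r, fun u j => 1 / u j,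
      fun u => LinearMap.toContinuousLinearMap
        (Matrix.toLin' (Matrix.diagonal fun j : Fin n => -(u j ^ 2)⁻¹)), ?_, ?_, ?_, ?_, ?_, rfl⟩
    · exact isSemialgebraicMapOn_cremona r'.isSemialgebraic_domain fun u hu j => (hpos u hu j).ne'
    · exact fun u hu => (hasFDerivAt_cremona fun j => (hpos u hu j).ne').hasFDerivWithinAt
    · exact injOn_cremona _
    · rw [hr, hr', image_cremona]
    · intro u hu
      have hΦu : (fun j => 1 / u j) ∈ r.domain := by
        rw [hr]
        exact fun j => one_div_pos.2 (hpos u hu j)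
      rw [hr'i hu, hri hΦu, abs_det_cremonaJac]
      exact one_div_prod_mul_sq u (p (Fin.snoc (fun j => 1 / u j) 1))
  have h : KZ.Equivalent r' r := KZ.changeOfVariablesRel_subset_relations hmem
  exact h.symm

end Summit.KontsevichZagierPeriods.PhiFourHepp

end
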